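import Literature.NumberTheory.ModularForms.PoincareSeriesWeightTwoPeterssonPairingCS
import Mathlib.MeasureTheory.Integral.DominatedConvergence
import HarnessLib

/-!
# Hecke's limit in the weight-2 Petersson norm from uniform domination (the measure-theoretic half
# of stub T4 `stub_heckeL2`)

Topic `Literature/NumberTheory/ModularForms` (namespace `Literature.NumberTheory.ModularForms.PoincareWeightTwo`,
continuing `PoincareSeriesWeightTwoHecke.lean`). THEOREMS ONLY. Abstract form of the passage from
pointwise convergence to convergence in the Petersson `L²` seminorm of `Γ₀(N)\ℍ`
(`peterssonPairing N 2 g g`, realised on `𝒟 = ModularGroup.fd` with the coset sum): if a family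
`E s : ℍ → ℂ` of continuous functions converges pointwise to a continuous `Q` as `s → 0⁺` and the
square-integrands `Σ_q |E s (q⁻¹τ)|² (Im q⁻¹τ)²` are dominated on `𝒟` by one integrable `G` for
`0 < s ≤ 1`, then `Q` and the `E s` are square-integrable and `Re⟨E s − Q, E s − Q⟩ → 0`
(dominated convergence). With `E s = yˢP_m(·,s)` (the Hecke-regularised weight-2 Poincaré series,
Iwaniec–Kowalski §14.1–§14.2 with §3.2) and `Q = poincareQSeries N m` this is the conclusion
`HeckeL2` of stub T4 of the I1 fact skeleton
`Summits/Parity/GeneralizedHardyLittlewood/Cruxes/PeterssonBoundPrinted/Lines/poincare_hecke.lean`,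
reduced to the UNIFORM DOMINATION near all cusps (the analytic half, card §T4).

* `peterssonSqIntegrable_of_le` — domination by an integrable function gives `PeterssonSqIntegrable`;
* `heckeL2_of_dominated` — the statement above.

## References

* [IwaniecKowalski2004] H. Iwaniec, E. Kowalski, *Analytic Number Theory*, §14.1 (14.11), §14.2,
  §3.2 (Hecke's trick).
-/

noncomputable section

open scoped MatrixGroups Real Topology
open CongruenceSubgroup Complex MeasureTheory Filter
open UpperHalfPlane hiding I

namespace Literature.NumberTheory.ModularForms.PoincareWeightTwo

variable {N : ℕ} [NeZero N]

/-- The square-integrand `Σ_q |g(q⁻¹τ)|² (Im q⁻¹τ)²` of a continuous `g` is continuous.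
[cite: IwaniecKowalski2004, (14.11)] -/
theorem continuous_sqIntegrand {g : ℍ → ℂ} (hg : Continuous g) :
    letI := Fintype.ofFinite (𝒮ℒ ⧸ (Gamma0 N : Subgroup (GL (Fin 2) ℝ)).subgroupOf 𝒮ℒ)
    Continuous fun τ : ℍ ↦ ∑ q : 𝒮ℒ ⧸ (Gamma0 N : Subgroup (GL (Fin 2) ℝ)).subgroupOf 𝒮ℒ,
      ‖g (((q.out : 𝒮ℒ) : GL (Fin 2) ℝ)⁻¹ • τ)‖ ^ 2 *
        ((((q.out : 𝒮ℒ) : GL (Fin 2) ℝ)⁻¹ • τ).im) ^ (2 : ℤ) := by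
  letI := Fintype.ofFinite (𝒮ℒ ⧸ (Gamma0 N : Subgroup (GL (Fin 2) ℝ)).subgroupOf 𝒮ℒ)
  refine continuous_finsetSum _ fun q _ ↦ ?_
  have hsm : Continuous fun τ : ℍ ↦ (((q.out : 𝒮ℒ) : GL (Fin 2) ℝ)⁻¹ • τ : ℍ) :=
    continuous_const_smul _
  refine Continuous.mul ((continuous_norm.comp (hg.comp hsm)).pow 2) ?_
  simp only [zpow_ofNat]
  exact (UpperHalfPlane.continuous_im.comp hsm).pow 2

/-- **Domination gives square-integrability**: if `Σ_q |g(q⁻¹τ)|² (Im q⁻¹τ)² ≤ G(τ)` on `𝒟` with `G`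
integrable on `𝒟` and `g` continuous, then `PeterssonSqIntegrable N 2 g`. [cite: IwaniecKowalski2004, (14.11)] -/
theorem peterssonSqIntegrable_of_le {g : ℍ → ℂ} (hg : Continuous g) {G : ℍ → ℝ}
    (hG : IntegrableOn G ModularGroup.fd)
    (hle : letI := Fintype.ofFinite (𝒮ℒ ⧸ (Gamma0 N : Subgroup (GL (Fin 2) ℝ)).subgroupOf 𝒮ℒ)
      ∀ τ ∈ ModularGroup.fd, ∑ q : 𝒮ℒ ⧸ (Gamma0 N : Subgroup (GL (Fin 2) ℝ)).subgroupOf 𝒮ℒ,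
        ‖g (((q.out : 𝒮ℒ) : GL (Fin 2) ℝ)⁻¹ • τ)‖ ^ 2 *
          ((((q.out : 𝒮ℒ) : GL (Fin 2) ℝ)⁻¹ • τ).im) ^ (2 : ℤ) ≤ G τ) :
    PeterssonSqIntegrable N 2 g := by
  letI := Fintype.ofFinite (𝒮ℒ ⧸ (Gamma0 N : Subgroup (GL (Fin 2) ℝ)).subgroupOf 𝒮ℒ)
  unfold PeterssonSqIntegrable
  refine Integrable.mono' hG (continuous_sqIntegrand hg).aestronglyMeasurable.restrict ?_
  refine (ae_restrict_iff' ModularGroup.isClosed_fd.measurableSet).mpr (ae_of_all _ fun τ hτ ↦ ?_)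
  rw [Real.norm_eq_abs, abs_of_nonneg (Finset.sum_nonneg fun q _ ↦
    mul_nonneg (sq_nonneg _) (zpow_pos (UpperHalfPlane.im_pos _) _).le)]
  exact hle τ hτ

/-- **Hecke's limit in the Petersson norm from uniform domination** (the measure-theoretic half of
stub T4 of the I1 skeleton): let `E s, Q : ℍ → ℂ` be continuous with `E s → Q` pointwise as
`s → 0⁺`, and let one integrable `G` dominate the square-integrands of all `E s`, `0 < s ≤ 1`, on `𝒟`.
Then `Q` and the `E s` (`0 < s ≤ 1`) are square-integrable and `Re⟨E s − Q, E s − Q⟩ → 0`.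
[cite: IwaniecKowalski2004, §14.2 (k = 2, Hecke's trick §3.2)] -/
theorem heckeL2_of_dominated (E : ℝ → ℍ → ℂ) (Q : ℍ → ℂ) (G : ℍ → ℝ)
    (hE : ∀ s : ℝ, 0 < s → s ≤ 1 → Continuous (E s)) (hQ : Continuous Q)
    (hG : IntegrableOn G ModularGroup.fd)
    (hdom : letI := Fintype.ofFinite (𝒮ℒ ⧸ (Gamma0 N : Subgroup (GL (Fin 2) ℝ)).subgroupOf 𝒮ℒ)
      ∀ s : ℝ, 0 < s → s ≤ 1 → ∀ τ ∈ ModularGroup.fd,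
        ∑ q : 𝒮ℒ ⧸ (Gamma0 N : Subgroup (GL (Fin 2) ℝ)).subgroupOf 𝒮ℒ,
          ‖E s (((q.out : 𝒮ℒ) : GL (Fin 2) ℝ)⁻¹ • τ)‖ ^ 2 *
            ((((q.out : 𝒮ℒ) : GL (Fin 2) ℝ)⁻¹ • τ).im) ^ (2 : ℤ) ≤ G τ)
    (hlim : ∀ z : ℍ, Tendsto (fun s : ℝ ↦ E s z) (𝓝[>] 0) (𝓝 (Q z))) :
    PeterssonSqIntegrable N 2 Q ∧
    (∀ s : ℝ, 0 < s → s ≤ 1 → PeterssonSqIntegrable N 2 (E s)) ∧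
    Tendsto (fun s : ℝ ↦ (peterssonPairing N 2 (fun z ↦ E s z - Q z) (fun z ↦ E s z - Q z)).re)
      (𝓝[>] 0) (𝓝 0) := by
  letI := Fintype.ofFinite (𝒮ℒ ⧸ (Gamma0 N : Subgroup (GL (Fin 2) ℝ)).subgroupOf 𝒮ℒ)
  -- abbreviations for the translates
  set w : (𝒮ℒ ⧸ (Gamma0 N : Subgroup (GL (Fin 2) ℝ)).subgroupOf 𝒮ℒ) → ℍ → ℍ :=
    fun q τ ↦ (((q.out : 𝒮ℒ) : GL (Fin 2) ℝ)⁻¹ • τ : ℍ) with hw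
  have him : ∀ q τ, 0 < (w q τ).im := fun q τ ↦ UpperHalfPlane.im_pos _
  -- the pointwise limit of the square-integrands: domination passes to `Q`
  have hQdom : ∀ τ ∈ ModularGroup.fd,
      ∑ q, ‖Q (w q τ)‖ ^ 2 * ((w q τ).im) ^ (2 : ℤ) ≤ G τ := by
    intro τ hτ
    have hconv : Tendsto (fun s : ℝ ↦ ∑ q, ‖E s (w q τ)‖ ^ 2 * ((w q τ).im) ^ (2 : ℤ))
        (𝓝[>] 0) (𝓝 (∑ q, ‖Q (w q τ)‖ ^ 2 * ((w q τ).im) ^ (2 : ℤ))) :=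
      tendsto_finsetSum _ fun q _ ↦
        ((continuous_norm.continuousAt.tendsto.comp (hlim (w q τ))).pow 2).mul_const _
    refine le_of_tendsto hconv ?_
    filter_upwards [Ioo_mem_nhdsGT (show (0 : ℝ) < 1 by norm_num)] with s hs
    exact hdom s hs.1 hs.2.le τ hτ
  have hQint : PeterssonSqIntegrable N 2 Q := peterssonSqIntegrable_of_le hQ hG hQdom
  have hEint : ∀ s : ℝ, 0 < s → s ≤ 1 → PeterssonSqIntegrable N 2 (E s) :=
    fun s hs hs1 ↦ peterssonSqIntegrable_of_le (hE s hs hs1) hG (hdom s hs hs1)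
  refine ⟨hQint, hEint, ?_⟩
  -- the difference: `Re⟨D_s, D_s⟩ = ∫_𝒟 Σ_q |D_s|² Im²` with `|D_s|² ≤ 2|E_s|² + 2|Q|²`, dominated by `4G`
  have hre : ∀ s : ℝ, (peterssonPairing N 2 (fun z ↦ E s z - Q z) (fun z ↦ E s z - Q z)).re =
      ∫ τ in ModularGroup.fd, ∑ q, ‖E s (w q τ) - Q (w q τ)‖ ^ 2 * ((w q τ).im) ^ (2 : ℤ) :=
    fun s ↦ peterssonPairing_self_re _
  simp_rw [hre]
  have key := tendsto_integral_filter_of_dominated_convergence (μ := volume.restrict ModularGroup.fd)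
    (l := 𝓝[>] (0 : ℝ))
    (F := fun (s : ℝ) (τ : ℍ) ↦ ∑ q, ‖E s (w q τ) - Q (w q τ)‖ ^ 2 * ((w q τ).im) ^ (2 : ℤ))
    (f := fun _ : ℍ ↦ (0 : ℝ)) (fun τ ↦ 4 * G τ) ?_ ?_ (hG.const_mul 4) ?_
  · simpa using key
  · -- measurability, for `s ∈ (0,1)`
    filter_upwards [Ioo_mem_nhdsGT (show (0 : ℝ) < 1 by norm_num)] with s hs
    exact (continuous_sqIntegrand ((hE s hs.1 hs.2.le).sub hQ)).aestronglyMeasurable.restrict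
  · -- domination by `4G`
    filter_upwards [Ioo_mem_nhdsGT (show (0 : ℝ) < 1 by norm_num)] with s hs
    refine (ae_restrict_iff' ModularGroup.isClosed_fd.measurableSet).mpr (ae_of_all _ fun τ hτ ↦ ?_)
    rw [Real.norm_eq_abs, abs_of_nonneg (Finset.sum_nonneg fun q _ ↦
      mul_nonneg (sq_nonneg _) (zpow_pos (him q τ) _).le)]
    have h1 := hdom s hs.1 hs.2.le τ hτ
    have h2 := hQdom τ hτ
    calc ∑ q, ‖E s (w q τ) - Q (w q τ)‖ ^ 2 * ((w q τ).im) ^ (2 : ℤ)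
        ≤ ∑ q, (2 * ‖E s (w q τ)‖ ^ 2 + 2 * ‖Q (w q τ)‖ ^ 2) * ((w q τ).im) ^ (2 : ℤ) := by
          refine Finset.sum_le_sum fun q _ ↦ mul_le_mul_of_nonneg_right ?_ (zpow_pos (him q τ) _).le
          have hab := mul_self_le_mul_self (norm_nonneg _) (norm_sub_le (E s (w q τ)) (Q (w q τ)))
          nlinarith [sq_nonneg (‖E s (w q τ)‖ - ‖Q (w q τ)‖), hab]
      _ = 2 * ∑ q, ‖E s (w q τ)‖ ^ 2 * ((w q τ).im) ^ (2 : ℤ) +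
            2 * ∑ q, ‖Q (w q τ)‖ ^ 2 * ((w q τ).im) ^ (2 : ℤ) := by
          rw [Finset.mul_sum, Finset.mul_sum, ← Finset.sum_add_distrib]
          refine Finset.sum_congr rfl fun q _ ↦ by ring
      _ ≤ 2 * G τ + 2 * G τ := by gcongr
      _ = 4 * G τ := by ring
  · -- pointwise convergence to `0`
    refine (ae_restrict_iff' ModularGroup.isClosed_fd.measurableSet).mpr (ae_of_all _ fun τ _ ↦ ?_)
    have h := tendsto_finsetSum (Finset.univ) fun (q : 𝒮ℒ ⧸ (Gamma0 N : Subgroup (GL (Fin 2) ℝ)).subgroupOf 𝒮ℒ) _ ↦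
      ((continuous_norm.continuousAt.tendsto.comp ((hlim (w q τ)).sub_const (Q (w q τ)))).pow 2).mul_const
        (((w q τ).im) ^ (2 : ℤ))
    simpa using h

end Literature.NumberTheory.ModularForms.PoincareWeightTwo

end
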